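import Literature.AlgebraicGeometry.Motives.AbelianVarietyQuasiIdempotentImageDual
import Literature.AlgebraicGeometry.ComplexMultiplication.TateModuleOfCMFreeRankOne
import Literature.NumberTheory.DiophantineGeometry.AVGaloisModuleTateRankOfCubeProofs
import Literature.LinearAlgebra.BaseChange.EndomorphismAlgebraImageBaseChange
import Mathlib.LinearAlgebra.Dual.Lemmas
import HarnessLib

/-!
# The `ℓ`-adic RANK of a quasi-idempotent endomorphism is twice the dimension of its image

D. Mumford, *Abelian Varieties* (1970), §19: Thm. 1 (p. 173: `Im u` is an abelian subvariety, `u = (X ↠ Im u ↪ X)`), Thm. 3 (p. 176: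
`T_ℓ` is faithful and exact up to isogeny) and p. 172 («`V_ℓ(X) ≅ ℚ_ℓ^{2g}`»); [Liu2021] App. D, proof of Thm. D.6 (1) (p. 140 l. 29–31):
the dimension of the block `B = Im u₀` of the Jacobian is read off the rank of the projector on cohomology.

For an abelian variety `X` over ANY field `K`, a quasi-idempotent `u : X ⟶ X` (`u ≫ u = a • u`, `a ≠ 0`) and a prime `ℓ` invertible in `K`:
* `rationalTateModuleMap_imageι_injective` — `V_ℓ(Im u ↪ X)` is injective (left inverse `a⁻¹ · V_ℓ ū`, ★ `rationalTateModuleMap_toImage_comp_imageι`);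
* `range_rationalTateModuleMap_eq_range_imageι`, `finrank_range_rationalTateModuleMap_eq` — `Im V_ℓ(u) = Im V_ℓ(ι) ≅ V_ℓ(Im u)`
  (★ `rationalTateModuleMap_toImage_surjective`);
* **`finrank_range_rationalTateModuleMap_eq_two_mul_dim`** — `rank_{ℚ_ℓ} V_ℓ(u) = 2 · dim(Im u)` (★ `finrank_rationalTateModule_eq_two_mul_dim`,
  unconditional);
* `finrank_range_rationalTateAction_eq_two_mul_dim` — the same for the RATIONAL element `e ∈ End⁰(X)` with `1 ⊗ u = a • e` (e.g. the
  idempotent `e = a⁻¹(1 ⊗ u)`): `rank_{ℚ_ℓ} (rationalTateAction X ℓ e) = 2 · dim(Im u)`; dual form `finrank_range_dualMap_rationalTateAction_eq_two_mul_dim`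
  and the base-changed form `finrank_range_baseChange_rationalTateAction_eq_two_mul_dim` (any field `R′ ⊇ ℚ_ℓ`, e.g. `ℚ̄_ℓ`; ★
  `baseChange_range`, ★ `finrank_baseChange_eq`).

Theorems only; no definition, no named fact, no instance, no `sorry`.  DICTIONARY LINE (cell `hodgecm-mathlib`, crux `HLiu418` =
stmt-HodgeConjecture-24832, d6 S2′ `BlockShape′` DEGREE conjunct, census `A-provers/A-p11/g12/CENSUS-S2prime-degree.A-p11g12.md` (D4a)):
`2·dim(Im(d·e)) = rank(e ⊗ 1 ∣ ℚ̄_ℓ ⊗ V_ℓ(A_K))` — the étale half of the degree identity; the Betti half is (D1) ★-pending p753523 +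
(D2)/(D3).  Count-neutral (HC_CM is proved only modulo the 7 printed citations until rung 0 closes).

## References
* [MumfordAV1970] D. Mumford, *Abelian Varieties* (1970), §19 Thm. 1 (p. 173), p. 172, Thm. 3 (p. 176).
* [Liu2021] Y. Liu, *Fourier–Jacobi cycles and arithmetic relative trace formula*, Camb. J. Math. 9 (2021), App. D, proof of Thm. D.6 (1) (p. 140).
-/

set_option autoImplicit false

noncomputable section

open CategoryTheory Module
open scoped TensorProduct

universe u

namespace Literature.AlgebraicGeometry.Motives

namespace AbelianVariety

variable {K : Type u} [Field K] (ℓ : ℕ) [Fact ℓ.Prime] {X : AbelianVariety K} {u : X ⟶ X} {a : ℕ}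

/-! ## §1 `V_ℓ` of the inclusion `Im u ↪ X` and the range of `V_ℓ(u)` -/

/-- **`V_ℓ(Im u ↪ X)` is injective** for a quasi-idempotent `u` (`V_ℓ ū ∘ V_ℓ ι = a ≠ 0`). [cite: MumfordAV1970, §19 Thm. 3 (p. 176)] -/
theorem rationalTateModuleMap_imageι_injective (hu : u ≫ u = a • u) (ha : a ≠ 0) :
    Function.Injective (rationalTateModuleMap ℓ (imageι u)) := by
  intro x y hxy
  have hc := rationalTateModuleMap_toImage_comp_imageι ℓ hu
  have hx := LinearMap.congr_fun hc x
  have hy := LinearMap.congr_fun hc y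
  simp only [LinearMap.coe_comp, Function.comp_apply, LinearMap.smul_apply, LinearMap.id_coe, id_eq] at hx hy
  have h := congrArg (rationalTateModuleMap ℓ (toImage u)) hxy
  rw [hx, hy] at h
  exact smul_right_injective _ (Nat.cast_ne_zero.2 ha : (a : ℚ_[ℓ]) ≠ 0) h

/-- `Im V_ℓ(u) = Im V_ℓ(Im u ↪ X)` (`V_ℓ u = V_ℓ ι ∘ V_ℓ ū` with `V_ℓ ū` onto). [cite: MumfordAV1970, §19 Thm. 1 (p. 173) and Thm. 3 (p. 176)] -/
theorem range_rationalTateModuleMap_eq_range_imageι (hu : u ≫ u = a • u) (ha : a ≠ 0) :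
    LinearMap.range (rationalTateModuleMap ℓ u) = LinearMap.range (rationalTateModuleMap ℓ (imageι u)) := by
  rw [← rationalTateModuleMap_imageι_comp_toImage ℓ u]
  exact LinearMap.range_comp_of_range_eq_top _ (LinearMap.range_eq_top.2 (rationalTateModuleMap_toImage_surjective ℓ hu ha))

/-- `dim Im V_ℓ(u) = dim V_ℓ(Im u)`. [cite: MumfordAV1970, §19 Thm. 1 (p. 173) and Thm. 3 (p. 176)] -/
theorem finrank_range_rationalTateModuleMap_eq (hu : u ≫ u = a • u) (ha : a ≠ 0) :
    finrank ℚ_[ℓ] (LinearMap.range (rationalTateModuleMap ℓ u)) = finrank ℚ_[ℓ] ((image u).rationalTateModule ℓ) := by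
  rw [range_rationalTateModuleMap_eq_range_imageι ℓ hu ha,
    LinearMap.finrank_range_of_inj (rationalTateModuleMap_imageι_injective ℓ hu ha)]

/-! ## §2 The rank is twice the dimension of the image -/

/-- **`rank_{ℚ_ℓ} V_ℓ(u) = 2 · dim(Im u)`** for a quasi-idempotent `u` and a prime `ℓ` invertible in `K`.
[cite: MumfordAV1970, §19 p. 172 and Thm. 1 (p. 173)] [cite: Liu2021, App. D, proof of Thm. D.6 (1) (p. 140)] -/
theorem finrank_range_rationalTateModuleMap_eq_two_mul_dim (hu : u ≫ u = a • u) (ha : a ≠ 0) (hℓ : (ℓ : K) ≠ 0) :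
    finrank ℚ_[ℓ] (LinearMap.range (rationalTateModuleMap ℓ u)) = 2 * (image u).dim := by
  rw [finrank_range_rationalTateModuleMap_eq ℓ hu ha, (image u).finrank_rationalTateModule_eq_two_mul_dim ℓ hℓ]

/-- **The rank of the rational projector**: if `1 ⊗ u = a • e` in `End⁰(X)` (`e` rational, e.g. the idempotent `a⁻¹(1 ⊗ u)`), then
`rank_{ℚ_ℓ} (rationalTateAction X ℓ e) = 2 · dim(Im u)`. [cite: MumfordAV1970, §19 p. 172 and Thm. 3 (p. 176)]
[cite: Liu2021, App. D, proof of Thm. D.6 (1) (p. 140)] -/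
theorem finrank_range_rationalTateAction_eq_two_mul_dim (hu : u ≫ u = a • u) (ha : a ≠ 0) (hℓ : (ℓ : K) ≠ 0)
    {e : X.endAlgebra} (he : endAlgebra.of X u = (a : ℚ) • e) :
    finrank ℚ_[ℓ] (LinearMap.range (rationalTateAction X ℓ e)) = 2 * (image u).dim := by
  have h : rationalTateModuleMap ℓ u = (a : ℚ_[ℓ]) • rationalTateAction X ℓ e := by
    rw [← rationalTateAction_of, he, Algebra.smul_def, map_mul, rationalTateAction_algebraMap, map_natCast, ← Algebra.smul_def]
  rw [← finrank_range_rationalTateModuleMap_eq_two_mul_dim ℓ hu ha hℓ, h,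
    LinearMap.range_smul _ _ (Nat.cast_ne_zero.2 ha)]

/-- Dual form: `rank_{ℚ_ℓ} ᵗ(rationalTateAction X ℓ e) = 2 · dim(Im u)`. [cite: MumfordAV1970, §19 p. 172 and Thm. 3 (p. 176)] -/
theorem finrank_range_dualMap_rationalTateAction_eq_two_mul_dim (hu : u ≫ u = a • u) (ha : a ≠ 0) (hℓ : (ℓ : K) ≠ 0)
    {e : X.endAlgebra} (he : endAlgebra.of X u = (a : ℚ) • e) :
    finrank ℚ_[ℓ] (LinearMap.range (rationalTateAction X ℓ e).dualMap) = 2 * (image u).dim := by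
  rw [LinearMap.finrank_range_dualMap_eq_finrank_range, finrank_range_rationalTateAction_eq_two_mul_dim ℓ hu ha hℓ he]

/-- Base-changed form: for any field `R′ ⊇ ℚ_ℓ` (e.g. `ℚ̄_ℓ`), `rank_{R′} (1 ⊗ ᵗ(rationalTateAction X ℓ e)) = 2 · dim(Im u)` on
`R′ ⊗ (V_ℓ X)^∨` (right exactness and flatness of `R′/ℚ_ℓ`). [cite: MumfordAV1970, §19 p. 172 and Thm. 3 (p. 176)] -/
theorem finrank_range_baseChange_dualMap_rationalTateAction_eq_two_mul_dim (hu : u ≫ u = a • u) (ha : a ≠ 0)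
    (hℓ : (ℓ : K) ≠ 0) {e : X.endAlgebra} (he : endAlgebra.of X u = (a : ℚ) • e) (R' : Type*) [Field R'] [Algebra ℚ_[ℓ] R'] :
    finrank R' (LinearMap.range (((rationalTateAction X ℓ e).dualMap).baseChange R')) = 2 * (image u).dim := by
  rw [← Literature.LinearAlgebra.BaseChange.baseChange_range, Literature.LinearAlgebra.BaseChange.finrank_baseChange_eq,
    finrank_range_dualMap_rationalTateAction_eq_two_mul_dim ℓ hu ha hℓ he]

end AbelianVariety

end Literature.AlgebraicGeometry.Motives

end
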